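import Literature.CategoryTheory.Preadditive.KrullSchmidtObjects
import HarnessLib

/-!
# A Krull–Schmidt category has split idempotents (Krause, Cor. 4.4: «Krull-Schmidt ⟺ split idempotents and semiperfect
# endomorphism rings», now at the level of the whole category)

Topic `Literature/CategoryTheory/Preadditive`, namespace `Literature.CategoryTheory.KrullSchmidt` (with a ring-theoretic §1 in
`Literature.RingTheory.Idempotents`); sequel of `KrullSchmidtObjects` (seat p39 g37-#10: `End X` is semiperfect iff `X` is a finite
biproduct of local-`End` objects, the ⟸ half WITHOUT idempotent completeness), `KrullSchmidtUniqueness` (p39 g36-#15: projection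
idempotents of `X ≅ ⨁ Xⱼ`), `KrullSchmidtDecompositionExistence` (g36: split pairs and corners) and of the ring theory
`LocalIdempotentsKrullSchmidt` (g36-#10: Lam Ex. 21.17 `exists_equiv_isIsoIdempotent_of_isLocalRing`), `SemiperfectRings` (g37-#1),
`SemiperfectCornersQuotients` (g37-#9: `completeOrthogonalIdempotents_sigma_val`, corner of a corner).

Krause [Krause2015KS], **Corollary 4.4.** «An additive category is a Krull-Schmidt category if and only if it has split idempotents and
the endomorphism ring of every object is semi-perfect.»  Proof: «The assertion follows from Proposition 4.1 once we know that a
Krull-Schmidt category has split idempotents. But this is clear since there is an equivalence `add X ⥲ proj Γ` for `Γ = End_𝒜(X)` …».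
Here (preadditive categories with finite biproducts; «Krull–Schmidt category» = every object is a finite biproduct of objects with local
endomorphism rings, [Krause2015KS, §4, first paragraph]) the hidden step «a Krull-Schmidt category has split idempotents» is proved through
the idempotents of `Γ = End X` directly: an idempotent `p ∈ Γ` is an orthogonal sum of LOCAL idempotents each ISOMORPHIC (Lam (21.20)) to
one of the projection idempotents `eⱼ` of a Krull–Schmidt decomposition `X ≅ ⨁ Xⱼ` (§1, Lam (23.6) + Ex. 21.17 in the semiperfect ring
`Γ`); an idempotent isomorphic to a split idempotent splits (§2), and an orthogonal sum of split idempotents splits through the biproduct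
of the images (§2); hence `p` splits (§3).

## What is formalised

* §1 (rings) **`exists_orthogonalIdempotents_sum_eq_forall_isIsoIdempotent`**: in a semiperfect ring with a complete orthogonal family
  `(eⱼ)` of local idempotents, every idempotent `p` is a finite orthogonal sum `p = Σ gₖ` of idempotents with every `gₖ ≅ e_{j(k)}`
  («every finitely generated projective is a direct sum of the `Reⱼ`», idempotent form).
* §2 `exists_split_of_isIsoIdempotent_of_split` (isomorphic to a split idempotent ⟹ split), `split_sum_of_orthogonalIdempotents`
  (orthogonal split idempotents: the sum splits through `⨁` of the images).
* §3 **`isIdempotentComplete_of_forall_exists_iso_biproduct_isLocalRing_end`** («a Krull-Schmidt category has split idempotents») and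
  **`forall_exists_iso_biproduct_isLocalRing_end_iff` = KRAUSE COR. 4.4 for the category**: every object is a finite biproduct of
  local-`End` objects iff `C` is idempotent complete and every `End X` is semiperfect; Hom-finite corollary
  `forall_exists_iso_biproduct_isLocalRing_end_iff_isIdempotentComplete_of_finite`.

Theorems only, 0 `sorry`, no definition (no `IsKrullSchmidt` class is introduced — the property is spelled out), no named fact (net debt 0,
D-0026); no instance, no notation.

## Mathlib / Literature search

Mathlib: `CategoryTheory.IsIdempotentComplete` (`idempotents_split`), `biproduct.lift ∕ desc ∕ lift_desc ∕ ι_π_ne ∕ ι_π_self`,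
`CategoryTheory.End.mul_def` (`f * g = g ≫ f`); no Krull–Schmidt categories.  Literature: `rg "IsIdempotentComplete C :=|: IsIdempotentComplete"
lean/Literature` → 0 results producing idempotent completeness; all g36∕g37 files ASSUME `[IsIdempotentComplete C]`.

## References

* H. Krause, *Krull–Schmidt categories and projective covers*, Expo. Math. 33 (2015): §4, Prop. 4.1, Cor. 4.4. [Krause2015KS]
* T. Y. Lam, *A First Course in Noncommutative Rings*, 2nd ed. (2001): §21 Prop. (21.20), Ex. 21.17; §23 Thm. (23.6), Thm. (23.8).
  [Lam2001FirstCourse]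
* A. Shah, *Krull–Remak–Schmidt decompositions in Hom-finite additive categories*, Expo. Math. 41 (2023): Def. 3.8, Thm. 6.1. [Shah2023KRS]

## Provenance

Lane `lit-hodgefound` (summit `HodgeConjecture`, Track 2 foundations library), seat `lit-hodgefound-p39` (literature-prover, generation 37,
row g37-#12); Krause materialised as paper-arxiv-1410.2822 (p0008).
-/

open CategoryTheory CategoryTheory.Limits

/-! ## §1 Idempotents of a semiperfect ring against a complete local family -/

namespace Literature.RingTheory.Idempotents

variable {R : Type*} [Ring R]

/-- **In a semiperfect ring with `1 = Σⱼ eⱼ` (orthogonal, local corners), every idempotent `p` is a finite orthogonal sum `p = Σₖ gₖ` of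
idempotents each ISOMORPHIC to some `eⱼ`** — decompose `p` and `1 − p` inside their (semiperfect, AF 27.7) corners into local idempotents
(Lam (23.6)), glue to a complete local family and match it with `(eⱼ)` by Lam's Ex. 21.17. [cite: Lam2001FirstCourse, §23 Thm. (23.6),
Rem. (23.7); §21 Ex. 21.17, Prop. (21.20)] [cite: AndersonFuller1992, Cor. 27.7, Thm. 27.11] -/
theorem exists_orthogonalIdempotents_sum_eq_forall_isIsoIdempotent [IsSemiperfectRing R] {ι : Type*} [Fintype ι] [DecidableEq ι]
    {e : ι → R} (he : CompleteOrthogonalIdempotents e) (hloc : ∀ i, IsLocalRing (he.idem i).Corner) {p : R} (hp : IsIdempotentElem p) :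
    ∃ (m : ℕ) (g : Fin m → R), OrthogonalIdempotents g ∧ ∑ k, g k = p ∧ ∀ k, ∃ i, IsIsoIdempotent (g k) (e i) := by
  classical
  have hpair : CompleteOrthogonalIdempotents ![p, 1 - p] := CompleteOrthogonalIdempotents.of_isIdempotentElem hp
  have hfam : ∀ i : Fin 2, ∃ (n : ℕ) (g : Fin n → (hpair.idem i).Corner) (hg : CompleteOrthogonalIdempotents g),
      ∀ k, IsLocalRing (hg.idem k).Corner := fun i => by
    haveI := Corner.isSemiperfectRing (hpair.idem i)
    exact exists_completeOrthogonalIdempotents_isLocalRing_corner_of_isSemiperfectRing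
  choose n g hg hgloc using hfam
  have hG := completeOrthogonalIdempotents_sigma_val hpair hg
  have hGloc : ∀ q : Σ i, Fin (n i), IsLocalRing (hG.idem q).Corner := fun q => by
    haveI := hgloc q.1 q.2
    exact (Corner.isLocalRing_corner_val_iff (hpair.idem q.1) ((hg q.1).idem q.2)).2 (hgloc q.1 q.2)
  obtain ⟨σ, hσ⟩ := exists_equiv_isIsoIdempotent_of_isLocalRing hG he hGloc hloc
  refine ⟨n 0, fun k => (g 0 k).1, hG.toOrthogonalIdempotents.embedding ⟨fun k => ⟨0, k⟩, fun k l h => eq_of_heq (Sigma.mk.inj h).2⟩,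
    ?_, fun k => ⟨σ ⟨0, k⟩, hσ ⟨0, k⟩⟩⟩
  have h1 : (∑ k, g 0 k).1 = p := congrArg Subtype.val (hg 0).complete
  exact (Corner.val_sum (hpair.idem 0) Finset.univ (g 0)).symm.trans h1

end Literature.RingTheory.Idempotents

namespace Literature.CategoryTheory.KrullSchmidt

open Literature.RingTheory.Idempotents (IsSemiperfectRing IsIsoIdempotent)

universe v u

variable {C : Type u} [Category.{v} C] [Preadditive C]

/-! ## §2 Split idempotents: closed under isomorphism of idempotents and orthogonal sums -/

section Split

omit [Preadditive C] in
/-- **An idempotent isomorphic (Lam (21.20): `g = ab`, `e = ba`) to a SPLIT idempotent `e = πι` splits** — through the same object, by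
`π′ = b a b π` and `ι′ = ι a b a` (`ι′π′ = ι e³ π = 1`, `π′ι′ = b e³ a = g² = g`). [cite: Lam2001FirstCourse, §21 Prop. (21.20)]
[cite: Shah2023KRS, Def. 3.8] [cite: Krause2015KS, Cor. 4.4 (proof)] -/
theorem exists_split_of_isIsoIdempotent_of_split {X Y : C} {g e : End X} (h : IsIsoIdempotent g e) (hg : IsIdempotentElem g)
    (he : IsIdempotentElem e) (ι : Y ⟶ X) (π : X ⟶ Y) (hιπ : ι ≫ π = 𝟙 Y) (hπι : End.of (π ≫ ι) = e) :
    ∃ (ι' : Y ⟶ X) (π' : X ⟶ Y), ι' ≫ π' = 𝟙 Y ∧ End.of (π' ≫ ι') = g := by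
  obtain ⟨a, b, hab, hba⟩ := h
  -- as morphisms: `b ≫ a = g`, `a ≫ b = e`, `π ≫ ι = e`, `e ≫ e = e`, `g ≫ g = g`
  have hab' : End.asHom b ≫ End.asHom a = End.asHom g := hab
  have hba' : End.asHom a ≫ End.asHom b = End.asHom e := hba
  have hπι' : π ≫ ι = End.asHom e := hπι
  have he2 : End.asHom e ≫ End.asHom e = End.asHom e := he.eq
  have hg2 : End.asHom g ≫ End.asHom g = End.asHom g := hg.eq
  refine ⟨ι ≫ End.asHom a ≫ End.asHom b ≫ End.asHom a, End.asHom b ≫ End.asHom a ≫ End.asHom b ≫ π, ?_, ?_⟩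
  · calc (ι ≫ End.asHom a ≫ End.asHom b ≫ End.asHom a) ≫ End.asHom b ≫ End.asHom a ≫ End.asHom b ≫ π
        = ι ≫ End.asHom e ≫ π := by simp only [Category.assoc, reassoc_of% hba', reassoc_of% he2]
      _ = 𝟙 Y := by rw [← hπι', Category.assoc, reassoc_of% hιπ, hιπ]
  · show (End.asHom b ≫ End.asHom a ≫ End.asHom b ≫ π) ≫ ι ≫ End.asHom a ≫ End.asHom b ≫ End.asHom a = End.asHom g
    calc (End.asHom b ≫ End.asHom a ≫ End.asHom b ≫ π) ≫ ι ≫ End.asHom a ≫ End.asHom b ≫ End.asHom a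
        = End.asHom b ≫ End.asHom e ≫ End.asHom a := by
          simp only [Category.assoc, reassoc_of% hπι', reassoc_of% hba', reassoc_of% he2]
      _ = End.asHom g := by rw [← hba', Category.assoc, reassoc_of% hab', hab', hg2]

/-- **An orthogonal family of split idempotents `gₖ = πₖιₖ` sums to a split idempotent: `Σ gₖ` splits through `⨁ₖ Yₖ`** via
`(πₖ)ₖ : X ⟶ ⨁ Yₖ` and `(ιₖ)ₖ : ⨁ Yₖ ⟶ X` (orthogonality gives `ιₖ π_{k′} = 0` for `k ≠ k′`). [cite: Krause2015KS, §2, Cor. 4.4 (proof)]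
[cite: Shah2023KRS, Def. 3.8, proof of Thm. 6.1] -/
theorem split_sum_of_orthogonalIdempotents [HasFiniteBiproducts C] {X : C} {m : ℕ} {g : Fin m → End X}
    (hg : OrthogonalIdempotents g) (Y : Fin m → C) (ι : ∀ k, Y k ⟶ X) (π : ∀ k, X ⟶ Y k) (hιπ : ∀ k, ι k ≫ π k = 𝟙 (Y k))
    (hπι : ∀ k, End.of (π k ≫ ι k) = g k) :
    biproduct.desc ι ≫ biproduct.lift π = 𝟙 (⨁ Y) ∧ biproduct.lift π ≫ biproduct.desc ι = ∑ k, End.asHom (g k) := by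
  classical
  have hπι' : ∀ k, π k ≫ ι k = End.asHom (g k) := fun k => hπι k
  -- `ιₖ ≫ π_{k′} = 0` for `k ≠ k′`
  have hcross : ∀ k k', k ≠ k' → ι k ≫ π k' = 0 := fun k k' hkk' => by
    have h0 : (π k ≫ ι k) ≫ (π k' ≫ ι k') = 0 := by
      rw [hπι' k, hπι' k']
      exact hg.ortho (Ne.symm hkk')
    calc ι k ≫ π k' = (ι k ≫ π k) ≫ ι k ≫ π k' ≫ (ι k' ≫ π k') := by rw [hιπ k, hιπ k', Category.id_comp, Category.comp_id]
      _ = ι k ≫ ((π k ≫ ι k) ≫ (π k' ≫ ι k')) ≫ π k' := by simp only [Category.assoc]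
      _ = 0 := by rw [h0, zero_comp, comp_zero]
  constructor
  · apply biproduct.hom_ext
    intro k'
    apply biproduct.hom_ext'
    intro k
    simp only [Category.assoc, biproduct.ι_desc_assoc, biproduct.lift_π, Category.id_comp]
    by_cases hkk' : k = k'
    · subst hkk'
      rw [hιπ, biproduct.ι_π_self]
    · rw [hcross k k' hkk', biproduct.ι_π_ne _ hkk']
  · rw [biproduct.lift_desc]
    exact Finset.sum_congr rfl fun k _ => hπι' k

end Split

/-! ## §3 Krull–Schmidt categories are idempotent complete; Krause Cor. 4.4 for the category -/

section KrauseCategory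

variable [HasFiniteBiproducts C]

/-- **«A Krull-Schmidt category has split idempotents»**: if every object of a preadditive category with finite biproducts is a finite
biproduct of objects with local endomorphism rings, then every idempotent splits.  (For `p = p² ∈ End X`, `X ≅ ⨁ Xⱼ`: `End X` is
semiperfect, `p = Σ gₖ` with `gₖ ≅ e_{j(k)}` (§1), each `gₖ` splits through `X_{j(k)}` (§2), so `p` splits through `⨁ₖ X_{j(k)}`.)
[cite: Krause2015KS, Cor. 4.4 (proof: «a Krull-Schmidt category has split idempotents»)] [cite: Lam2001FirstCourse, §23 Thm. (23.6), §21
Ex. 21.17] -/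
theorem isIdempotentComplete_of_forall_exists_iso_biproduct_isLocalRing_end
    (h : ∀ X : C, ∃ (n : ℕ) (Y : Fin n → C), Nonempty (X ≅ ⨁ Y) ∧ ∀ j, IsLocalRing (End (Y j))) : IsIdempotentComplete C := by
  classical
  refine ⟨fun X p hp => ?_⟩
  obtain ⟨n, Xs, ⟨i⟩, hloc⟩ := h X
  haveI := isSemiperfectRing_end_of_iso_biproduct_isLocalRing_end i hloc
  have he := completeOrthogonalIdempotents_of_iso_biproduct i
  have hp' : IsIdempotentElem (End.of p) := hp
  obtain ⟨m, g, hg, hsum, hiso⟩ :=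
    Literature.RingTheory.Idempotents.exists_orthogonalIdempotents_sum_eq_forall_isIsoIdempotent he
      (fun j => (isLocalRing_corner_iff_of_iso_biproduct i j).2 (hloc j)) hp'
  choose j hj using hiso
  have hsplit : ∀ k, ∃ (ι' : Xs (j k) ⟶ X) (π' : X ⟶ Xs (j k)), ι' ≫ π' = 𝟙 _ ∧ End.of (π' ≫ ι') = g k := fun k =>
    exists_split_of_isIsoIdempotent_of_split (hj k) (hg.idem k) (he.idem (j k)) (biproduct.ι Xs (j k) ≫ i.inv)
      (i.hom ≫ biproduct.π Xs (j k)) (biproductIncl_comp_proj i (j k)) rfl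
  choose ι' π' hιπ' hπι' using hsplit
  obtain ⟨h₁, h₂⟩ := split_sum_of_orthogonalIdempotents hg (fun k => Xs (j k)) ι' π' hιπ' hπι'
  refine ⟨⨁ (fun k => Xs (j k)), biproduct.desc ι', biproduct.lift π', h₁, ?_⟩
  rw [h₂]
  have hsum' : ∑ k, End.asHom (g k) = End.asHom (∑ k, g k) := rfl
  rw [hsum', hsum]

/-- **KRAUSE COROLLARY 4.4 (for a preadditive category with finite biproducts): every object is a finite biproduct of objects with
local endomorphism rings iff the category is idempotent complete and every endomorphism ring is semiperfect.** [cite: Krause2015KS,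
Cor. 4.4, Prop. 4.1] [cite: Lam2001FirstCourse, §23 Thm. (23.6), Thm. (23.8)] -/
theorem forall_exists_iso_biproduct_isLocalRing_end_iff :
    (∀ X : C, ∃ (n : ℕ) (Y : Fin n → C), Nonempty (X ≅ ⨁ Y) ∧ ∀ j, IsLocalRing (End (Y j))) ↔
      IsIdempotentComplete C ∧ ∀ X : C, IsSemiperfectRing (End X) := by
  constructor
  · intro h
    refine ⟨isIdempotentComplete_of_forall_exists_iso_biproduct_isLocalRing_end h, fun X => ?_⟩
    obtain ⟨n, Y, ⟨i⟩, hl⟩ := h X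
    exact isSemiperfectRing_end_of_iso_biproduct_isLocalRing_end i hl
  · rintro ⟨hI, hS⟩ X
    haveI := hS X
    exact exists_iso_biproduct_isLocalRing_end_of_isSemiperfectRing X

/-- The same with Krull–Remak–Schmidt decompositions (indecomposable summands with local endomorphism rings). [cite: Krause2015KS,
Cor. 4.4, Thm. 4.2] [cite: Shah2023KRS, Def. 4.6, Thm. 6.1] -/
theorem forall_exists_iso_biproduct_indecomposable_iff [HasBinaryBiproducts C] :
    (∀ X : C, ∃ (n : ℕ) (Y : Fin n → C), Nonempty (X ≅ ⨁ Y) ∧ ∀ j, Indecomposable (Y j) ∧ IsLocalRing (End (Y j))) ↔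
      IsIdempotentComplete C ∧ ∀ X : C, IsSemiperfectRing (End X) := by
  rw [← forall_exists_iso_biproduct_isLocalRing_end_iff]
  refine ⟨fun h X => ?_, fun h X => ?_⟩
  · obtain ⟨n, Y, hY, hl⟩ := h X
    exact ⟨n, Y, hY, fun j => (hl j).2⟩
  · obtain ⟨n, Y, hY, hl⟩ := h X
    exact ⟨n, Y, hY, fun j => by haveI := hl j; exact ⟨indecomposable_of_isLocalRing_end, hl j⟩⟩

/-- **Hom-finite categories: Krull–Schmidt ⟺ idempotent complete.**  If every `End X` is a finite-dimensional algebra over a field `k`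
(so semiperfect), then every object is a finite biproduct of local-`End` objects iff `C` is idempotent complete. [cite: Krause2015KS,
Cor. 4.4] [cite: Shah2023KRS, Thm. 6.1, Cor. 6.3] -/
theorem forall_exists_iso_biproduct_isLocalRing_end_iff_isIdempotentComplete_of_finite (k : Type*) [Field k] [Linear k C]
    [∀ X : C, Module.Finite k (End X)] :
    (∀ X : C, ∃ (n : ℕ) (Y : Fin n → C), Nonempty (X ≅ ⨁ Y) ∧ ∀ j, IsLocalRing (End (Y j))) ↔ IsIdempotentComplete C := by
  rw [forall_exists_iso_biproduct_isLocalRing_end_iff]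
  exact ⟨fun h => h.1, fun h => ⟨h, fun X =>
    haveI : IsArtinianRing (End X) := IsArtinianRing.of_finite k (End X)
    Literature.RingTheory.Idempotents.isSemiperfectRing_of_isArtinianRing⟩⟩

/-- Likewise when every `End X` is left artinian. [cite: Krause2015KS, Cor. 4.4] [cite: Shah2023KRS, Thm. 6.1] -/
theorem forall_exists_iso_biproduct_isLocalRing_end_iff_isIdempotentComplete_of_isArtinianRing [∀ X : C, IsArtinianRing (End X)] :
    (∀ X : C, ∃ (n : ℕ) (Y : Fin n → C), Nonempty (X ≅ ⨁ Y) ∧ ∀ j, IsLocalRing (End (Y j))) ↔ IsIdempotentComplete C := by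
  rw [forall_exists_iso_biproduct_isLocalRing_end_iff]
  exact ⟨fun h => h.1, fun h => ⟨h, fun X => Literature.RingTheory.Idempotents.isSemiperfectRing_of_isArtinianRing⟩⟩

end KrauseCategory

end Literature.CategoryTheory.KrullSchmidt
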